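import Summits.RiemannHypothesis.RiemannHypothesis.Theorems.LiTailLaguerreFejerAngle
import HarnessLib

/-!
# RiemannHypothesis / LiTailLaguerre — Fejér companion, part 1b: the two phases of the Laguerre bridge (RH-FREE)

RH-FREE [rh-li-eng].  Cell `pub/rh-li`, round 7; sequel to `Theorems/LiTailLaguerreFejerAngle.lean`.  With
`ϑ = Fejer.angS` (`= liZeroAngle` on `t > 0`): the two phases of `2(1 − cos nϑ) cos(ty) = 2cos(ty) − cos F − cos G`,
`F(t) = yt + nϑ(t)` (stationary at `t₀ = √(n/y − ¼)`, `F″ = nϑ″ ≥ 0`) and `G(t) = yt − nϑ(t)` (`G′ ≥ y`, `G″ ≤ 0`);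
for `n ≥ 2y`: `t₀ ≥ 1`, `u(t₀) = 4n/y`, `n = y(t₀² + ¼)`, `F′(t₀) = 0`, `F″(t₀) = 2t₀y²/n`; the first-derivative gaps
`F′ ≤ −y` on `[0, t₀/2]` and `F′ ≥ y/2` on `[2t₀, ∞)`; the Graham–Kolesnik inputs `F″ ≥ n/(20t₀³)`, `|F‴| ≤ 100n/t₀⁴`,
`|F⁗| ≤ 1000n/t₀⁵` on `[t₀/2, 2t₀]`; and the phase value `|F(t₀) − 2√(ny)| ≤ y/(4t₀) + n/(12t₀³)`
(`2yt₀ ≤ 2√(ny) ≤ 2yt₀ + y/(4t₀)`, `1/t − 1/(12t³) ≤ θ(t) ≤ 1/t`).  Nothing here bears on the truth of RH.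
-/

noncomputable section

-- D-0017: `Summit.<S>.<S>.…` is the designed namespace of a single-problem summit.
set_option linter.dupNamespace false

open Set

namespace Summit.RiemannHypothesis.RiemannHypothesis.Theorems.LiTheory

namespace Fejer

/-! ### The two phases -/

/-- The stationary phase `F(t) = yt + nϑ(t)` (`cos(ty + nθ)`-piece of the bridge). -/
def phF (n : ℕ) (y t : ℝ) : ℝ := y * t + n * angS t

/-- `F' = y + nϑ' = y − 4n/u`. -/
def phF1 (n : ℕ) (y t : ℝ) : ℝ := y + n * angD1 t

/-- `F'' = nϑ''`. -/
def phF2 (n : ℕ) (t : ℝ) : ℝ := n * angD2 t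

/-- `F''' = nϑ'''`. -/
def phF3 (n : ℕ) (t : ℝ) : ℝ := n * angD3 t

/-- `F'''' = nϑ''''`. -/
def phF4 (n : ℕ) (t : ℝ) : ℝ := n * angD4 t

/-- The non-stationary phase `G(t) = yt − nϑ(t)` (`cos(ty − nθ)`-piece of the bridge). -/
def phG (n : ℕ) (y t : ℝ) : ℝ := y * t - n * angS t

/-- `G' = y − nϑ' = y + 4n/u`. -/
def phG1 (n : ℕ) (y t : ℝ) : ℝ := y - n * angD1 t

/-- `G'' = −nϑ''`. -/
def phG2 (n : ℕ) (t : ℝ) : ℝ := -(n * angD2 t)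

/-- `F′ = phF1`. -/
theorem hasDerivAt_phF (n : ℕ) (y t : ℝ) : HasDerivAt (phF n y) (phF1 n y t) t := by
  have h : HasDerivAt (fun t : ℝ ↦ y * t + n * angS t) (y * 1 + n * angD1 t) t :=
    (((hasDerivAt_id' t).const_mul y)).add ((hasDerivAt_angS t).const_mul (n : ℝ))
  refine h.congr_deriv ?_
  unfold phF1; ring

/-- `F″ = phF2`. -/
theorem hasDerivAt_phF1 (n : ℕ) (y t : ℝ) : HasDerivAt (phF1 n y) (phF2 n t) t := by
  have h := ((hasDerivAt_angD1 t).const_mul (n : ℝ)).const_add y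
  exact h

/-- `F‴ = phF3`. -/
theorem hasDerivAt_phF2 (n : ℕ) (t : ℝ) : HasDerivAt (phF2 n) (phF3 n t) t :=
  (hasDerivAt_angD2 t).const_mul (n : ℝ)

/-- `F⁗ = phF4`. -/
theorem hasDerivAt_phF3 (n : ℕ) (t : ℝ) : HasDerivAt (phF3 n) (phF4 n t) t :=
  (hasDerivAt_angD3 t).const_mul (n : ℝ)

/-- `G′ = phG1`. -/
theorem hasDerivAt_phG (n : ℕ) (y t : ℝ) : HasDerivAt (phG n y) (phG1 n y t) t := by
  have h : HasDerivAt (fun t : ℝ ↦ y * t - n * angS t) (y * 1 - n * angD1 t) t :=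
    (((hasDerivAt_id' t).const_mul y)).sub ((hasDerivAt_angS t).const_mul (n : ℝ))
  refine h.congr_deriv ?_
  unfold phG1; ring

/-- `G″ = phG2`. -/
theorem hasDerivAt_phG1 (n : ℕ) (y t : ℝ) : HasDerivAt (phG1 n y) (phG2 n t) t := by
  have h : HasDerivAt (fun t : ℝ ↦ y - n * angD1 t) (-(n * angD2 t)) t :=
    ((hasDerivAt_angD1 t).const_mul (n : ℝ)).const_sub y
  exact h

/-- `F'' ≥ 0` on `t ≥ 0`. -/
theorem phF2_nonneg (n : ℕ) {t : ℝ} (ht : 0 ≤ t) : 0 ≤ phF2 n t :=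
  mul_nonneg n.cast_nonneg (angD2_nonneg ht)

/-- `G'' ≤ 0` on `t ≥ 0`. -/
theorem phG2_nonpos (n : ℕ) {t : ℝ} (ht : 0 ≤ t) : phG2 n t ≤ 0 := by
  unfold phG2; linarith [phF2_nonneg n ht, show phF2 n t = n * angD2 t from rfl]

/-- `F″` is continuous. -/
theorem continuous_phF2 (n : ℕ) : Continuous (phF2 n) := continuous_const.mul continuous_angD2

/-- `G″` is continuous. -/
theorem continuous_phG2 (n : ℕ) : Continuous (phG2 n) := (continuous_const.mul continuous_angD2).neg

/-- `ϑ` is continuous. -/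
theorem continuous_angS : Continuous angS := by unfold angS; fun_prop

/-- `F` is continuous. -/
theorem continuous_phF (n : ℕ) (y : ℝ) : Continuous (phF n y) := by
  unfold phF; exact (continuous_const.mul continuous_id).add (continuous_const.mul continuous_angS)

/-- `G` is continuous. -/
theorem continuous_phG (n : ℕ) (y : ℝ) : Continuous (phG n y) := by
  unfold phG; exact (continuous_const.mul continuous_id).sub (continuous_const.mul continuous_angS)

/-- `G' ≥ y` everywhere (`−nϑ' = 4n/u ≥ 0`). -/
theorem phG1_ge (n : ℕ) (y t : ℝ) : y ≤ phG1 n y t := by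
  unfold phG1 angD1
  have hu := uS_pos t
  have : n * (-4 / uS t) ≤ 0 := by
    apply mul_nonpos_of_nonneg_of_nonpos n.cast_nonneg
    exact div_nonpos_of_nonpos_of_nonneg (by norm_num) hu.le
  linarith

/-! ### The stationary point -/

/-- The stationary point `t₀ = √(n/y − ¼)` of `F`. -/
def tz (n : ℕ) (y : ℝ) : ℝ := Real.sqrt (n / y - 1 / 4)

/-- Under `0 < y`, `2y ≤ n`: `t₀² = n/y − ¼`, `t₀ ≥ 1`, `u(t₀) = 4n/y`, `n = y(t₀² + ¼)`. -/
theorem tz_facts {n : ℕ} {y : ℝ} (hy : 0 < y) (hn : 2 * y ≤ n) :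
    tz n y ^ 2 = n / y - 1 / 4 ∧ 1 ≤ tz n y ∧ uS (tz n y) = 4 * n / y ∧ (n : ℝ) = y * (tz n y ^ 2 + 1 / 4) := by
  have hny : 2 ≤ (n : ℝ) / y := by rw [le_div_iff₀ hy]; linarith
  have h0 : 0 ≤ (n : ℝ) / y - 1 / 4 := by linarith
  have hsq : tz n y ^ 2 = n / y - 1 / 4 := by unfold tz; rw [Real.sq_sqrt h0]
  refine ⟨hsq, ?_, ?_, ?_⟩
  · unfold tz
    rw [show (1 : ℝ) = Real.sqrt 1 from Real.sqrt_one.symm]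
    exact Real.sqrt_le_sqrt (by linarith)
  · unfold uS; rw [hsq]; field_simp; ring
  · rw [hsq]; field_simp; ring

/-- `t₀ > 0` under the same hypotheses. -/
theorem tz_pos {n : ℕ} {y : ℝ} (hy : 0 < y) (hn : 2 * y ≤ n) : 0 < tz n y := by
  linarith [(tz_facts hy hn).2.1]

/-- `F'(t₀) = 0`. -/
theorem phF1_tz {n : ℕ} {y : ℝ} (hy : 0 < y) (hn : 2 * y ≤ n) : phF1 n y (tz n y) = 0 := by
  obtain ⟨_, _, hu, _⟩ := tz_facts hy hn
  have hn0 : (0 : ℝ) < n := by have : (0:ℝ) < 2 * y := by positivity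
                               linarith
  unfold phF1 angD1
  rw [hu]
  field_simp
  ring

/-- `F''(t₀) = 2t₀y²/n` (`> 0`). -/
theorem phF2_tz {n : ℕ} {y : ℝ} (hy : 0 < y) (hn : 2 * y ≤ n) :
    phF2 n (tz n y) = 2 * tz n y * y ^ 2 / n := by
  obtain ⟨_, _, hu, _⟩ := tz_facts hy hn
  have hn0 : (0 : ℝ) < n := by have : (0:ℝ) < 2 * y := by positivity
                               linarith
  unfold phF2 angD2
  rw [hu]
  field_simp
  ring

/-- `F″(t₀) > 0`. -/
theorem phF2_tz_pos {n : ℕ} {y : ℝ} (hy : 0 < y) (hn : 2 * y ≤ n) : 0 < phF2 n (tz n y) := by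
  rw [phF2_tz hy hn]
  have := tz_pos hy hn
  have hn0 : (0 : ℝ) < n := by have : (0:ℝ) < 2 * y := by positivity
                               linarith
  positivity

/-! ### First-derivative gaps away from the stationary point -/

/-- `F' ≤ −y` on `[0, t₀/2]` (for `n ≥ 2y`). -/
theorem phF1_le_neg {n : ℕ} {y t : ℝ} (hy : 0 < y) (hn : 2 * y ≤ n) (ht0 : 0 ≤ t) (ht : t ≤ tz n y / 2) :
    phF1 n y t ≤ -y := by
  obtain ⟨hsq, h1, _, hny⟩ := tz_facts hy hn
  have hu0 := uS_pos t
  -- `u(t) ≤ 1 + t₀² = n/y + 3/4`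
  have hu : uS t ≤ 1 + tz n y ^ 2 := by unfold uS; nlinarith
  have hn0 : (0 : ℝ) < n := by have : (0:ℝ) < 2 * y := by positivity
                               linarith
  unfold phF1 angD1
  -- `4n/u ≥ 4n/(1 + t₀²) ≥ 2y`
  have hkey : 2 * y ≤ 4 * n / uS t := by
    rw [le_div_iff₀ hu0]
    calc 2 * y * uS t ≤ 2 * y * (1 + tz n y ^ 2) := by gcongr
      _ = 2 * y + 2 * (y * (tz n y ^ 2 + 1 / 4)) - y / 2 := by ring
      _ = 2 * y + 2 * n - y / 2 := by rw [← hny]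
      _ ≤ 4 * n := by linarith
  have : (n : ℝ) * (-4 / uS t) = -(4 * n / uS t) := by ring
  rw [this]; linarith

/-- `F' ≥ y/2` on `[2t₀, ∞)` (for `n ≥ 2y`). -/
theorem phF1_ge {n : ℕ} {y t : ℝ} (hy : 0 < y) (hn : 2 * y ≤ n) (ht : 2 * tz n y ≤ t) :
    y / 2 ≤ phF1 n y t := by
  obtain ⟨hsq, h1, _, hny⟩ := tz_facts hy hn
  have hu0 := uS_pos t
  have ht0 : 0 ≤ t := by linarith
  -- `u(t) ≥ 1 + 16 t₀²`
  have hu : 1 + 16 * tz n y ^ 2 ≤ uS t := by unfold uS; nlinarith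
  have hn0 : (0 : ℝ) < n := by have : (0:ℝ) < 2 * y := by positivity
                               linarith
  unfold phF1 angD1
  -- `4n/u ≤ 4n/(1 + 16t₀²) ≤ y/2` since `8n ≤ y(1 + 16 t₀²) = 16 n − 3y`
  have hden : 0 < 1 + 16 * tz n y ^ 2 := by positivity
  have hkey : 4 * n / uS t ≤ y / 2 := by
    calc 4 * n / uS t ≤ 4 * n / (1 + 16 * tz n y ^ 2) :=
          div_le_div_of_nonneg_left (by positivity) hden hu
      _ ≤ y / 2 := by
          rw [div_le_iff₀ hden]
          have : y / 2 * (1 + 16 * tz n y ^ 2) = 16 * (y * (tz n y ^ 2 + 1 / 4)) / 2 - 3 * y / 2 := by ring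
          rw [this, ← hny]
          linarith
  have : (n : ℝ) * (-4 / uS t) = -(4 * n / uS t) := by ring
  rw [this]; linarith

/-! ### GK inputs on `[t₀/2, 2t₀]` -/

/-- On `[t₀/2, 2t₀]`: `F'' ≥ n/(20 t₀³)`, `|F'''| ≤ 100 n/t₀⁴`, `|F''''| ≤ 1000 n/t₀⁵`. -/
theorem gk_bounds {n : ℕ} {y t : ℝ} (hy : 0 < y) (hn : 2 * y ≤ n)
    (ht : t ∈ Icc (tz n y / 2) (2 * tz n y)) :
    (n : ℝ) / (20 * tz n y ^ 3) ≤ phF2 n t ∧ |phF3 n t| ≤ 100 * n / tz n y ^ 4 ∧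
      |phF4 n t| ≤ 1000 * n / tz n y ^ 5 := by
  obtain ⟨_, h1, _, _⟩ := tz_facts hy hn
  have hs0 : 0 < tz n y := by linarith
  have hnn : (0 : ℝ) ≤ n := n.cast_nonneg
  refine ⟨?_, ?_, ?_⟩
  · unfold phF2
    calc (n : ℝ) / (20 * tz n y ^ 3) = n * (1 / (20 * tz n y ^ 3)) := by ring
      _ ≤ n * (16 / (289 * tz n y ^ 3)) := by
          apply mul_le_mul_of_nonneg_left _ hnn
          rw [div_le_div_iff₀ (by positivity) (by positivity)]
          nlinarith [pow_pos hs0 3]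
      _ ≤ n * angD2 t := mul_le_mul_of_nonneg_left (angD2_ge h1 ht) hnn
  · unfold phF3
    rw [abs_mul, Nat.abs_cast]
    calc (n : ℝ) * |angD3 t| ≤ n * (96 / tz n y ^ 4) := mul_le_mul_of_nonneg_left (abs_angD3_le h1 ht) hnn
      _ ≤ n * (100 / tz n y ^ 4) := by gcongr; norm_num
      _ = 100 * n / tz n y ^ 4 := by ring
  · unfold phF4
    rw [abs_mul, Nat.abs_cast]
    calc (n : ℝ) * |angD4 t| ≤ n * (768 / tz n y ^ 5) := mul_le_mul_of_nonneg_left (abs_angD4_le h1 ht) hnn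
      _ ≤ n * (1000 / tz n y ^ 5) := by gcongr; norm_num
      _ = 1000 * n / tz n y ^ 5 := by ring

/-! ### The phase value at the stationary point -/

/-- `2yt₀ ≤ 2√(ny) ≤ 2yt₀ + y/(4t₀)` (`n = y(t₀² + ¼)`, `t₀ ≤ √(t₀² + ¼) ≤ t₀ + 1/(8t₀)`). -/
theorem two_sqrt_bounds {n : ℕ} {y : ℝ} (hy : 0 < y) (hn : 2 * y ≤ n) :
    2 * y * tz n y ≤ 2 * Real.sqrt (n * y) ∧ 2 * Real.sqrt (n * y) ≤ 2 * y * tz n y + y / (4 * tz n y) := by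
  obtain ⟨hsq, h1, _, hny⟩ := tz_facts hy hn
  have hs0 : 0 < tz n y := by linarith
  have hprod : (n : ℝ) * y = y ^ 2 * (tz n y ^ 2 + 1 / 4) := by rw [hny]; ring
  have hroot : Real.sqrt (n * y) = y * Real.sqrt (tz n y ^ 2 + 1 / 4) := by
    rw [hprod, Real.sqrt_mul (sq_nonneg y), Real.sqrt_sq hy.le]
  rw [hroot]
  have hlo : tz n y ≤ Real.sqrt (tz n y ^ 2 + 1 / 4) := by
    rw [show tz n y = Real.sqrt (tz n y ^ 2) from (Real.sqrt_sq hs0.le).symm, Real.sqrt_sq hs0.le]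
    exact Real.sqrt_le_sqrt (by linarith)
  have hhi : Real.sqrt (tz n y ^ 2 + 1 / 4) ≤ tz n y + 1 / (8 * tz n y) := by
    rw [Real.sqrt_le_left (by positivity)]
    have : (tz n y + 1 / (8 * tz n y)) ^ 2 = tz n y ^ 2 + 1 / 4 + 1 / (64 * tz n y ^ 2) := by
      field_simp; ring
    rw [this]
    have : 0 < 1 / (64 * tz n y ^ 2) := by positivity
    linarith
  constructor
  · nlinarith
  · have : 2 * (y * (tz n y + 1 / (8 * tz n y))) = 2 * y * tz n y + y / (4 * tz n y) := by
      field_simp; ring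
    nlinarith

/-- `|F(t₀) − 2√(ny)| ≤ y/(4t₀) + n/(12t₀³)`. -/
theorem abs_phF_tz_sub_le {n : ℕ} {y : ℝ} (hy : 0 < y) (hn : 2 * y ≤ n) :
    |phF n y (tz n y) - 2 * Real.sqrt (n * y)| ≤ y / (4 * tz n y) + n / (12 * tz n y ^ 3) := by
  obtain ⟨hsq, h1, _, hny⟩ := tz_facts hy hn
  have hs0 : 0 < tz n y := by linarith
  obtain ⟨hlo, hhi⟩ := two_sqrt_bounds hy hn
  obtain ⟨ha0, ha1⟩ := SmoothReplace.inv_sub_liZeroAngle_bounds hs0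
  have hang : angS (tz n y) = liZeroAngle (tz n y) := angS_eq_liZeroAngle hs0
  have hnn : (0 : ℝ) ≤ n := n.cast_nonneg
  -- `y t₀ + n/t₀ = 2 y t₀ + y/(4 t₀)`
  have hsum : y * tz n y + n * (1 / tz n y) = 2 * y * tz n y + y / (4 * tz n y) := by
    rw [hny]; field_simp; ring
  unfold phF
  rw [hang, abs_le]
  have hθlo : n * (1 / tz n y) - n / (12 * tz n y ^ 3) ≤ n * liZeroAngle (tz n y) := by
    have := mul_le_mul_of_nonneg_left ha1 hnn
    have e : (n : ℝ) * (1 / (12 * tz n y ^ 3)) = n / (12 * tz n y ^ 3) := by ring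
    linarith
  have hθhi : n * liZeroAngle (tz n y) ≤ n * (1 / tz n y) := by
    have := mul_le_mul_of_nonneg_left ha0 hnn
    linarith
  have hp1 : 0 ≤ y / (4 * tz n y) := by positivity
  have hp2 : 0 ≤ (n : ℝ) / (12 * tz n y ^ 3) := by positivity
  constructor <;> linarith

end Fejer

end Summit.RiemannHypothesis.RiemannHypothesis.Theorems.LiTheory

end
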